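import Summits.ResolutionOfSingularities.ResolutionOfSingularities.Theorems.PurelyInseparableDim4RidgeBudget
import Summits.ResolutionOfSingularities.ResolutionOfSingularities.Theorems.PurelyInseparableDim4FreeTailConsequences
import HarnessLib
import HarnessLib.Audit.Tags

/-!
# F4-I(p,p) — the RIDGE TRICHOTOMY with its NARROW branch DISCHARGED: the residual of `NoIsolatedTrap p p`
# is exactly «no wide floor trap ∧ no above-floor trap», every prime `p`; at `p = 3` only the wide floor trap

[OURS · counted 0 · def-free glue inside OUR frame.]  Cell `res-dim4-pi` (D-0157 DOOR 2), F4-I(3,3) lane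
(seat res-dim4-p-12 g2).  Nothing here proves `NoIsolatedTrap 3 3`, `NoWideTrap`, or resolution of
singularities in dimension ≥ 4 / characteristic `p`.

idea-3's trichotomy `RidgeBudget.noIsolatedTrap_of_trichotomy` (CARD I-3-9, p659279) reduces F4-I(p,p) to
(N1) `NarrowDrop p p` + `NoWideTrap p p` + `NoAboveFloorTrap p p`.  The narrow branch does not need the
quantitative (N1): the tree's cone theorem `FreeTailProof.no_isolated_cone_chain_one` (p660329; FT(p,p) +
`IsolatedBand.no_isolated_cone_chain_one_of_freeTail`, the frame form of [CJS 2020] Cor. 5.37) already kills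
every infinite isolated `Step0 p` chain whose directrix letter `ē` is eventually `1` on the floor.  Hence:

* `noIsolatedTrap_of_residual` — `NoWideTrap p p → NoAboveFloorTrap p p → NoIsolatedTrap p p` (`p` prime),
  and the exact splitting `noIsolatedTrap_iff_residual : NoIsolatedTrap p p ↔ NoWideTrap p p ∧ NoAboveFloorTrap p p`.
* `noWideTrap_iff_coneTwo` — `NoWideTrap p p` (`ē ≥ 2` along the chain) is the same statement as «no
  infinite isolated floor chain with `ē = 2` throughout» (`ē ≤ 2` at clean floor states,
  `Directrix.finrank_additiveSubspace_initialForm_le_two`; shift the chain by one to make every state clean).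
* `noAboveFloorTrap_three : NoAboveFloorTrap 3 3` — K2(3) (`FreeTailProof.noIsolatedBandRun3`) through the
  order dichotomy `IsolatedBand.isolated_chain_order_dichotomy_three` (an isolated chain avoiding order `3`
  is an all-band chain from index `1`).
* `noIsolatedTrap_three_three_iff_noWideTrap : NoIsolatedTrap 3 3 ↔ NoWideTrap 3 3` — I-3-9's vocabulary
  meets p660329's `noIsolatedTrap_three_three_iff_coneTwo`: the ONE residual of F4-I(3,3) is the wide
  (`e = ē = 2`) floor trap, the territory of [CJS 2020] Thm. 5.40; `HeightBudget 3 3` is no handle on it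
  (false: crit-4 V-A4-10 / crit-1 K-A-14, witness H1).
The quantitative (N1⁺) «μ⁺ drops by ≥ 1 across a narrow edge» (CARD I-3-10; p-5 g2 / p-1 g2) remains the
sharper statement (explicit tail bound `≤ μ⁺ − 1`); this file only records that the QUALITATIVE narrow
branch is closed in the tree for every prime.
bears_on: LADDER-RESOLUTION:D157-DOOR2 (res-dim4-pi · F4-I(p,p) residual).  Supports
stmt-ResolutionOfSingularities-16155 (helper).
-/

set_option linter.dupNamespace false -- mandated namespace of this single-conjunct summit

noncomputable section

namespace Summit.ResolutionOfSingularities.ResolutionOfSingularities.Theorems.PIDim4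

namespace RidgeBudget

open MvPolynomial Finset
open Literature.AlgebraicGeometry.Resolution
open Literature.AlgebraicGeometry.Resolution.Hauser2010
open Literature.AlgebraicGeometry.Resolution.HauserPerlega2019
open PointBlowup (gradSpan additiveSubspace)

variable {K : Type} [Field K]

/-! ## 1. Every prime `p`: the narrow branch is discharged by the cone theorem -/

/-- **The trichotomy with (N1) discharged.**  `F4-I(p,p)` follows from «no wide floor trap» and «no
above-floor trap» alone: an infinite isolated chain is eventually on the floor or never
(`NoAboveFloorTrap`); on the floor `ē` stabilises at `e ∈ {1,2,3}` (`Directrix.step0_chain_eventually_constant`);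
`e ≥ 2` is a wide trap, and `e = 1` is excluded by the tree's cone theorem
`FreeTailProof.no_isolated_cone_chain_one` (FT(p,p), p660329).  [OURS · glue]
[cite: CossartJannsenSaito2020, Cor. 5.37] -/
theorem noIsolatedTrap_of_residual (p : ℕ) [Fact p.Prime] (hW : NoWideTrap p p)
    (hA : NoAboveFloorTrap p p) : NoIsolatedTrap p p := by
  intro K _ _ _
  rintro ⟨c, hc⟩
  -- either some state of index ≥ 1 is on the floor, or the shifted chain stays above it for ever
  by_cases hfloor : ∃ i, ordZero (c (i + 1)).F = p
  swap
  · push Not at hfloor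
    exact hA K ⟨fun k => c (k + 1), fun k => ⟨(hc (k + 1)).1, (hc (k + 1)).2, hfloor k⟩⟩
  obtain ⟨i, hi⟩ := hfloor
  -- the floor tail `d k = c (i + 1 + k)`
  set d : ℕ → State K := fun k => c (i + 1 + k) with hd
  have hdstep : ∀ k, Step0 p (d k) (d (k + 1)) := fun k => by
    have := (hc (i + 1 + k)).2
    simp only [hd]
    rwa [show i + 1 + (k + 1) = i + 1 + k + 1 by ring]
  have hdiso : ∀ k, IsIsolated p (d k).F := fun k => (hc (i + 1 + k)).1
  have hdord : ∀ k, ordZero (d k).F = p := fun k => (floor_tail p (fun k => (hc k).2) hi k).1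
  have hdgrad : gradSpan (initialForm (d 0).F) ≠ ⊥ := (floor_tail p (fun k => (hc k).2) hi 0).2
  obtain ⟨M, e, h1, -, hM⟩ := Directrix.step0_chain_eventually_constant p d hdstep (hdord 0) hdgrad
  by_cases he : 2 ≤ e
  · -- a wide trap
    refine hW K ⟨fun k => d (M + k), fun k => ⟨hdiso _, ?_, hdord _, ?_⟩⟩
    · have := hdstep (M + k)
      rwa [show M + k + 1 = M + (k + 1) by ring] at this
    · show 2 ≤ ebar (d (M + k)).F
      rw [ebar, hM (M + k) (Nat.le_add_right M k)]
      exact he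
  · -- the stable value is `1`: the cone theorem (FT(p,p)) forbids it
    have he1 : e = 1 := by omega
    refine FreeTailProof.no_isolated_cone_chain_one p hc (k₀ := i + 1 + M) (by omega) ?_ ?_
    · exact hdord M
    · intro k hk
      obtain ⟨m, rfl⟩ := Nat.exists_eq_add_of_le hk
      have h := hM (M + m) (Nat.le_add_right M m)
      rw [he1] at h
      rw [show i + 1 + M + m = i + 1 + (M + m) by ring]
      exact h

/-- **Exact splitting**: `NoIsolatedTrap p p ↔ NoWideTrap p p ∧ NoAboveFloorTrap p p` (`p` prime); the
two pieces are sub-cases (`noWideTrap_of_noIsolatedTrap`, `noAboveFloorTrap_of_noIsolatedTrap`).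
[OURS · glue] [folklore] -/
theorem noIsolatedTrap_iff_residual (p : ℕ) [Fact p.Prime] :
    NoIsolatedTrap p p ↔ NoWideTrap p p ∧ NoAboveFloorTrap p p :=
  ⟨fun h => ⟨noWideTrap_of_noIsolatedTrap p p h, noAboveFloorTrap_of_noIsolatedTrap p p h⟩,
    fun h => noIsolatedTrap_of_residual p h.1 h.2⟩

/-! ## 2. `NoWideTrap` is the `e = ē = 2` cone statement -/

/-- Along a `Step0 p` chain every state of index `k + 1` is clean, so a floor state there has `ē ≤ 2`
(`Directrix.finrank_additiveSubspace_initialForm_le_two`). [OURS · frame reading] [folklore] -/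
theorem ebar_succ_le_two (p : ℕ) [Fact p.Prime] [CharP K p] [DecidableEq K] {c : ℕ → State K}
    (hc : ∀ k, Step0 p (c k) (c (k + 1))) (k : ℕ) (hord : ordZero (c (k + 1)).F = p) :
    ebar (c (k + 1)).F ≤ 2 :=
  Directrix.finrank_additiveSubspace_initialForm_le_two p hord (IsolatedBand.isClean_of_step0 (hc k))

/-- **`NoWideTrap p p` ⟺ no infinite isolated floor chain with `ē = 2` throughout** (`p` prime): `⇐` shifts
a wide chain by one index, after which every state is clean and `2 ≤ ē ≤ 2`. [OURS · glue] [folklore] -/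
theorem noWideTrap_iff_coneTwo (p : ℕ) [Fact p.Prime] :
    NoWideTrap p p ↔ ∀ (K : Type) [Field K] [CharP K p] [DecidableEq K],
      ¬ ∃ c : ℕ → State K, ∀ k, IsIsolated p (c k).F ∧ Step0 p (c k) (c (k + 1)) ∧
        ordZero (c k).F = p ∧ ebar (c k).F = 2 := by
  constructor
  · intro h K _ _ _
    rintro ⟨c, hc⟩
    exact h K ⟨c, fun k => ⟨(hc k).1, (hc k).2.1, (hc k).2.2.1, (hc k).2.2.2.ge⟩⟩
  · intro h K _ _ _
    rintro ⟨c, hc⟩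
    refine h K ⟨fun k => c (k + 1), fun k => ⟨(hc (k + 1)).1, (hc (k + 1)).2.1, (hc (k + 1)).2.2.1, ?_⟩⟩
    exact le_antisymm (ebar_succ_le_two p (fun k => (hc k).2.1) k (hc (k + 1)).2.2.1) (hc (k + 1)).2.2.2

/-! ## 3. `p = 3`: no above-floor trap (K2(3)), so the residual is the wide floor trap alone -/

/-- **`NoAboveFloorTrap 3 3`** — an isolated `Step0 3` chain avoiding order `3` is an all-band chain
(`ord₀ = 4`) from index `1` (order dichotomy), excluded by K2(3) = `FreeTailProof.noIsolatedBandRun3`.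
[OURS · glue] [folklore] -/
theorem noAboveFloorTrap_three : NoAboveFloorTrap 3 3 := by
  intro K _ _ _
  rintro ⟨c, hc⟩
  have hc' : ∀ k, IsIsolated 3 (c k).F ∧ Step0 3 (c k) (c (k + 1)) := fun k => ⟨(hc k).1, (hc k).2.1⟩
  rcases IsolatedBand.isolated_chain_order_dichotomy_three hc' with hall | ⟨k₀, htail⟩
  · exact FreeTailProof.noIsolatedBandRun3 K
      ⟨fun k => c (k + 1), fun k => ⟨(hc (k + 1)).1, (hc (k + 1)).2.1, hall (k + 1) (by omega)⟩⟩
  · have h3 := htail k₀ le_rfl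
    exact (hc k₀).2.2 (by rw [h3]; exact Nat.cast_ofNat)

/-- **`NoIsolatedTrap 3 3 ↔ NoWideTrap 3 3`**: at `p = 3` the ONE residual of F4-I(3,3) in the ridge
trichotomy is the wide (`e = ē = 2`) floor trap — I-3-9's vocabulary for p660329's
`FreeTailProof.noIsolatedTrap_three_three_iff_coneTwo`. [OURS · glue]
[cite: CossartJannsenSaito2020, Thm. 5.40] -/
theorem noIsolatedTrap_three_three_iff_noWideTrap : NoIsolatedTrap 3 3 ↔ NoWideTrap 3 3 := by
  haveI : Fact (Nat.Prime 3) := ⟨Nat.prime_three⟩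
  rw [noIsolatedTrap_iff_residual 3]
  exact ⟨fun h => h.1, fun h => ⟨h, noAboveFloorTrap_three⟩⟩

/-- The same residual in the cone wording of p660329 (`ē = 2` exactly), for the record.
[OURS · glue] [cite: CossartJannsenSaito2020, Thm. 5.40] -/
theorem noIsolatedTrap_three_three_iff_coneTwo' :
    NoIsolatedTrap 3 3 ↔ ∀ (K : Type) [Field K] [CharP K 3] [DecidableEq K],
      ¬ ∃ c : ℕ → State K, ∀ k, IsIsolated 3 (c k).F ∧ Step0 3 (c k) (c (k + 1)) ∧
        ordZero (c k).F = (3 : ℕ) ∧ ebar (c k).F = 2 := by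
  haveI : Fact (Nat.Prime 3) := ⟨Nat.prime_three⟩
  rw [noIsolatedTrap_three_three_iff_noWideTrap, noWideTrap_iff_coneTwo 3]

end RidgeBudget

end Summit.ResolutionOfSingularities.ResolutionOfSingularities.Theorems.PIDim4

end
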